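import Summits.KontsevichZagierPeriods.KontsevichZagierPeriods.Theorems.SoloBlindTwelveSporadicPullback
import Summits.KontsevichZagierPeriods.KontsevichZagierPeriods.Theorems.SoloBlindFermatCubic
import HarnessLib

/-!
# A degree-four cover at level 18: `{2,3,13} ~ {3,7,8} ~ {1,3,14}` meets `{3,6,9} ~ {6,6,6} ~ …`

At level `N = 18` the first-kind Deligne–Koblitz–Ogus class of `B(1/6,1/3)` (`{3,6,9}`) consists
of the orbits `{3,6,9}, {6,6,6}, {3,3,12}` and `{2,3,13}, {3,7,8}, {1,3,14}`; inside the
Kontsevich–Zagier rules the duplication / triplication / quartic families connect each half, and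
nothing so far joins the two halves (the only first-kind merge missing at level `18`).  The
missing link is a rational map of degree `4` over the real field `ℚ(c, b)` of degree `9`,
`c = 2cos(2π/9)` (`c³ = 3c - 1`), `b = (-188 + 24c + 66c²)^{1/3} ≈ 1.5455`:

  `F(W) = b²(1 - W³) / Q(W)²`,  `Q = W² + αW + b`,  `α = (-2 + 6c - 3c²) b² ≈ 0.3598`,

with the two "miracles" (`en_key1`, `en_key2`)

  `Q² - b²(1 - W³) = W (W - p)³`,   `W⁴ - αW³ - 3bW² - 4W - 2α = (W - p)²(W² + uW + v)`,

`p = (1 - 4c + 2c²) b² ≈ -1.036`, `u = (4 - 14c + 7c²) b² ≈ -2.432`,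
`v = (1 - 4c + 2c²) b ≈ -0.670`.  Over `t = 0` the map has the four simple points
`{1, ζ₃, ζ₃², ∞}`, over `∞` the two double points `Q = 0`, over `1` the simple point `W = 0` and
the triple point `p`; the two free critical points (roots of `W² + uW + v`) lie outside `[0,1]`
(passport `[1⁴][2,2][3,1][2,1,1]²`).  So `F` maps `(0,1)` decreasingly onto `(0,1)`, and
(`SoloBlindEnneaCoverPullback`)

  `F^*(t^{-5/6}(1-t)^{-2/3}dt) = b^{1/3} · S(W) · W^{-2/3}(1-W³)^{-5/6} dW`,  `S = -v - uW - W²`,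

whose monomial pieces are `β((3j+1)/9, 1/6)` after `s = W³`.  Hence the relation
`3 B(1/6,1/3) = b^{1/3}(-v·β(1/9,1/6) - u·β(4/9,1/6) - β(7/9,1/6))` in the rules
(`SoloBlindEnneaCover`) and, with the quartic merges, `β(1/9,1/6) ≐ β(1/6,1/3)`: the in-rules
classes of first-kind Beta values at level `18` become the four DKO classes.  This file: the
constants (all in `K₀`) with their signs, `Q`, `S`, the key identities, the map `F` with its
derivative, monotonicity and `F((0,1)) = (0,1)`.  References: P. Deligne, *Valeurs de fonctions
L et périodes d'intégrales*, Proc. Symp. Pure Math. 33 (1979), appendix by N. Koblitz, A. Ogus;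
M. Kontsevich, D. Zagier, *Periods* (2001), §1.2.
-/

noncomputable section

open Set MeasureTheory MvPolynomial

namespace Summit.KontsevichZagierPeriods.KontsevichZagierPeriods.Theorems

namespace SoloBlind

open Literature.ModelTheory.ExponentialFields (IsSemialgebraic)
open Literature.NumberTheory.Transcendental
open Literature.NumberTheory.Transcendental.KZ

/-! ## `c = 2cos(2π/9)` -/

/-- `c = 2cos(2π/9) ≈ 1.53209`, the real root `> 1` of `c³ - 3c + 1`. -/
def c9 : ℝ := 2 * Real.cos (2 * Real.pi / 9)

/-- `c³ = 3c - 1` (the triple-angle formula at `2π/9`, `cos(2π/3) = -1/2`). -/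
theorem c9_cube : c9 ^ 3 = 3 * c9 - 1 := by
  have h := Real.cos_three_mul (2 * Real.pi / 9)
  have h2 : Real.cos (3 * (2 * Real.pi / 9)) = -1 / 2 := by
    rw [show 3 * (2 * Real.pi / 9) = Real.pi - Real.pi / 3 by ring, Real.cos_pi_sub,
      Real.cos_pi_div_three]
    norm_num
  rw [h2] at h
  unfold c9
  linear_combination (-2) * h

/-- `1 < c` (`cos(2π/9) > cos(π/3) = 1/2`). -/
theorem one_lt_c9 : 1 < c9 := by
  have h := Real.cos_lt_cos_of_nonneg_of_le_pi (by positivity)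
    (by linarith [Real.pi_pos] : Real.pi / 3 ≤ Real.pi)
    (by linarith [Real.pi_pos] : 2 * Real.pi / 9 < Real.pi / 3)
  rw [Real.cos_pi_div_three] at h
  unfold c9
  linarith

/-- `1.53 < c` (the cubic is negative on `[1, 1.53]`). -/
theorem c9_gt : 153 / 100 < c9 := by
  by_contra h
  push Not at h
  have h1 : 0 ≤ 153 / 100 - c9 := by linarith
  have h2 : 0 ≤ c9 - 1 := by linarith [one_lt_c9]
  nlinarith [c9_cube, mul_nonneg h1 (sq_nonneg c9), mul_nonneg h1 h2]

/-- `c < 1.54` (the cubic is positive on `[1.54, ∞)`). -/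
theorem c9_lt : c9 < 77 / 50 := by
  by_contra h
  push Not at h
  have h1 : 0 ≤ c9 - 77 / 50 := by linarith
  have h2 : 0 ≤ c9 - 1 := by linarith [one_lt_c9]
  nlinarith [c9_cube, mul_nonneg h1 (sq_nonneg c9), mul_nonneg h1 h2]

/-- `c` is algebraic. -/
theorem isAlgebraic_c9 : IsAlgebraic ℚ c9 := by
  have h := (Real.isAlgebraic_cos_rat_mul_pi (2 / 9)).extendScalars
    (R := ℤ) (S := ℚ) (A := ℝ) (RingHom.injective_int (algebraMap ℤ ℚ))
  rw [show (((2 / 9 : ℚ)) : ℝ) * Real.pi = 2 * Real.pi / 9 by push_cast; ring] at h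
  have h2 : IsAlgebraic ℚ (2:ℝ) := by simpa using isAlgebraic_rat ℚ (A := ℝ) 2
  exact h2.mul h

/-- `c` as an element of `K₀`. -/
def c9K : K₀ := ⟨c9, mem_K₀_iff.mpr isAlgebraic_c9⟩

/-- `x = -188 + 24c + 66c² = b³ ≈ 3.690`. -/
def enX : ℝ := -188 + 24 * c9 + 66 * c9 ^ 2

/-- `3 < x`. -/
theorem enX_gt : 3 < enX := by unfold enX; nlinarith [c9_gt, c9_lt]

/-- `b = x^{1/3} ≈ 1.5455`. -/
def bN : ℝ := enX ^ (1 / 3 : ℝ)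

/-- `0 < b`. -/
theorem bN_pos : 0 < bN := Real.rpow_pos_of_pos (three_pos.trans enX_gt) _

/-- `b³ = -188 + 24c + 66c²`. -/
theorem bN_cube : bN ^ 3 = -188 + 24 * c9 + 66 * c9 ^ 2 := by
  unfold bN
  rw [← Real.rpow_natCast, ← Real.rpow_mul (three_pos.trans enX_gt).le]
  norm_num
  rfl

/-- `1 < b`. -/
theorem one_lt_bN : 1 < bN := by
  by_contra h
  push Not at h
  have h3 : bN ^ 3 ≤ 1 := pow_le_one₀ bN_pos.le h
  have hx := enX_gt
  unfold enX at hx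
  linarith [bN_cube]

/-- `b` is algebraic. -/
theorem isAlgebraic_bN : IsAlgebraic ℚ bN := by
  have hx : IsAlgebraic ℚ enX :=
    isAlgebraic_of_K₀ (-188 + 24 * c9K + 66 * c9K ^ 2) (by push_cast; rfl)
  have h := Literature.NumberTheory.Transcendental.isAlgebraic_rpow_ratCast hx
    (three_pos.trans enX_gt) (1 / 3)
  push_cast at h
  exact h

/-- `b` as an element of `K₀`. -/
def bNK : K₀ := ⟨bN, mem_K₀_iff.mpr isAlgebraic_bN⟩

/-! ## The constants `α, p, u, v` -/

/-- `1/δ = -2 + 6c - 3c² ≈ 0.1506` (`δ = 3c² + 3c - 5`). -/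
def enI : ℝ := -2 + 6 * c9 - 3 * c9 ^ 2

/-- `1 - 4c + 2c² ≈ -0.4338`. -/
def enPc : ℝ := 1 - 4 * c9 + 2 * c9 ^ 2

/-- `4 - 14c + 7c² ≈ -1.018`. -/
def enUc : ℝ := 4 - 14 * c9 + 7 * c9 ^ 2

/-- `α = (-2 + 6c - 3c²) b² ≈ 0.3598`, the middle coefficient of `Q`. -/
def enAl : ℝ := enI * bN ^ 2

/-- `p = (1 - 4c + 2c²) b² ≈ -1.036`, the triple point of `F` over `t = 1`. -/
def enP : ℝ := enPc * bN ^ 2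

/-- `u = (4 - 14c + 7c²) b² ≈ -2.432`. -/
def enU : ℝ := enUc * bN ^ 2

/-- `v = (1 - 4c + 2c²) b ≈ -0.670`; `W² + uW + v` is the free factor of `F'`. -/
def enV : ℝ := enPc * bN

/-- `0 < 1/δ`. -/
theorem enI_pos : 0 < enI := by unfold enI; nlinarith [c9_gt, c9_lt]

/-- `1 - 4c + 2c² < -2/5`. -/
theorem enPc_lt : enPc < -2 / 5 := by unfold enPc; nlinarith [c9_gt, c9_lt]

/-- `4 - 14c + 7c² < -19/20`. -/
theorem enUc_lt : enUc < -19 / 20 := by unfold enUc; nlinarith [c9_gt, c9_lt]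

/-- `0 < α`. -/
theorem enAl_pos : 0 < enAl := mul_pos enI_pos (pow_pos bN_pos 2)

/-- `p < 0`. -/
theorem enP_neg : enP < 0 := mul_neg_of_neg_of_pos (by linarith [enPc_lt]) (pow_pos bN_pos 2)

/-- `u < -19/20`. -/
theorem enU_lt : enU < -19 / 20 := by
  have hb : 1 < bN ^ 2 := by nlinarith [one_lt_bN]
  have h : enUc * bN ^ 2 < enUc * 1 := mul_lt_mul_of_neg_left hb (by linarith [enUc_lt])
  unfold enU
  linarith [enUc_lt]

/-- `v < -2/5`. -/
theorem enV_lt : enV < -2 / 5 := by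
  have h : enPc * bN < enPc * 1 := mul_lt_mul_of_neg_left one_lt_bN (by linarith [enPc_lt])
  unfold enV
  linarith [enPc_lt]

/-- `u + v < -1`, which makes `S = -v - uW - W²` positive on `[0,1]`. -/
theorem enU_add_enV : enU + enV < -1 := by linarith [enU_lt, enV_lt]

/-- `α` is algebraic. -/
theorem isAlgebraic_enAl : IsAlgebraic ℚ enAl :=
  isAlgebraic_of_K₀ ((-2 + 6 * c9K - 3 * c9K ^ 2) * bNK ^ 2) (by push_cast; rfl)

/-- `p` is algebraic. -/
theorem isAlgebraic_enP : IsAlgebraic ℚ enP :=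
  isAlgebraic_of_K₀ ((1 - 4 * c9K + 2 * c9K ^ 2) * bNK ^ 2) (by push_cast; rfl)

/-- `u` is algebraic. -/
theorem isAlgebraic_enU : IsAlgebraic ℚ enU :=
  isAlgebraic_of_K₀ ((4 - 14 * c9K + 7 * c9K ^ 2) * bNK ^ 2) (by push_cast; rfl)

/-- `v` is algebraic. -/
theorem isAlgebraic_enV : IsAlgebraic ℚ enV :=
  isAlgebraic_of_K₀ ((1 - 4 * c9K + 2 * c9K ^ 2) * bNK) (by push_cast; rfl)

/-- `Q(W) = W² + αW + b`; `Q²` is the denominator of `F` (two double poles). -/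
def enQ (W : ℝ) : ℝ := W ^ 2 + enAl * W + bN

/-- `S(W) = -v - uW - W²`, minus the free factor of `F'` (its roots are the two real critical
points of `F` outside `[0,1]`). -/
def enS (W : ℝ) : ℝ := -enV - enU * W - W ^ 2

/-- `Q > 0` on `[0,∞)`. -/
theorem enQ_pos {W : ℝ} (h0 : 0 ≤ W) : 0 < enQ W := by
  unfold enQ; nlinarith [enAl_pos, bN_pos, sq_nonneg W]

/-- `S > 0` on `[0,1]` (`S` is concave, `S(0) = -v > 0`, `S(1) = -v - u - 1 > 0`). -/
theorem enS_pos {W : ℝ} (h0 : 0 ≤ W) (h1 : W ≤ 1) : 0 < enS W := by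
  have h2 : W ^ 2 ≤ W := by nlinarith
  have hA : 0 ≤ (1 - W) * (-enV) := mul_nonneg (by linarith) (by linarith [enV_lt])
  have hB : 0 ≤ W * (-enV - enU - 1) := mul_nonneg h0 (by linarith [enU_add_enV])
  have hC : 0 < (1 - W) * (-enV) + W * (-enV - enU - 1) := by
    rcases lt_or_ge W (1 / 2) with hW | hW
    · have : 0 < (1 - W) * (-enV) := mul_pos (by linarith) (by linarith [enV_lt])
      linarith
    · have : 0 < W * (-enV - enU - 1) := mul_pos (by linarith) (by linarith [enU_add_enV])
      linarith
  unfold enS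
  nlinarith

/-! ## The two key identities -/

/-- **First miracle:** `Q² - b²(1-W³) = W(W-p)³` — `1 - F` has a triple zero at `p`. -/
theorem en_key1 (W : ℝ) : enQ W ^ 2 - bN ^ 2 * (1 - W ^ 3) = W * (W - enP) ^ 3 := by
  unfold enQ enAl enP enI enPc
  linear_combination ((-192:ℝ)*W + (1:ℝ)*W*bN^3 + (2292:ℝ)*W*c9 + (-12:ℝ)*W*c9*bN^3 +
    (-10380:ℝ)*W*c9^2 + (54:ℝ)*W*c9^2*bN^3 + (21560:ℝ)*W*c9^3 + (-112:ℝ)*W*c9^3*bN^3 +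
    (-19428:ℝ)*W*c9^4 + (108:ℝ)*W*c9^4*bN^3 + (4224:ℝ)*W*c9^5 + (-48:ℝ)*W*c9^5*bN^3 +
    (4472:ℝ)*W*c9^6 + (8:ℝ)*W*c9^6*bN^3 + (-2976:ℝ)*W*c9^7 + (528:ℝ)*W*c9^8 + (1:ℝ)*W^2*bN +
    (-12:ℝ)*W^2*c9^2*bN + (12:ℝ)*W^2*c9^3*bN + (-3:ℝ)*W^2*c9^4*bN) * bN_cube + ((36096:ℝ)*W +
    (-327216:ℝ)*W*c9 + (1012128:ℝ)*W*c9^2 + (-1150840:ℝ)*W*c9^3 + (359520:ℝ)*W*c9^4 +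
    (229008:ℝ)*W*c9^5 + (-183744:ℝ)*W*c9^6 + (34848:ℝ)*W*c9^7 + (-186:ℝ)*W^2*bN +
    (-534:ℝ)*W^2*c9*bN + (720:ℝ)*W^2*c9^2*bN + (-198:ℝ)*W^2*c9^3*bN) * c9_cube

/-- **Second miracle:** `W⁴ - αW³ - 3bW² - 4W - 2α = -(W-p)² S(W)` — the numerator of `F'`
factors through `(W-p)²`. -/
theorem en_key2 (W : ℝ) :
    W ^ 4 - enAl * W ^ 3 - 3 * bN * W ^ 2 - 4 * W - 2 * enAl = -((W - enP) ^ 2 * enS W) := by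
  unfold enS enAl enP enU enV enI enPc enUc
  linear_combination ((-1:ℝ)*bN^2 + (12:ℝ)*c9*bN^2 + (-54:ℝ)*c9^2*bN^2 + (112:ℝ)*c9^3*bN^2 +
    (-108:ℝ)*c9^4*bN^2 + (48:ℝ)*c9^5*bN^2 + (-8:ℝ)*c9^6*bN^2 + (754:ℝ)*W + (-4:ℝ)*W*bN^3 +
    (-8760:ℝ)*W*c9 + (46:ℝ)*W*c9*bN^3 + (38292:ℝ)*W*c9^2 + (-199:ℝ)*W*c9^2*bN^3 +
    (-76972:ℝ)*W*c9^3 + (400:ℝ)*W*c9^3*bN^3 + (67914:ℝ)*W*c9^4 + (-380:ℝ)*W*c9^4*bN^3 +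
    (-14304:ℝ)*W*c9^5 + (168:ℝ)*W*c9^5*bN^3 + (-15784:ℝ)*W*c9^6 + (-28:ℝ)*W*c9^6*bN^3 +
    (10416:ℝ)*W*c9^7 + (-1848:ℝ)*W*c9^8 + (7:ℝ)*W^2*bN + (-52:ℝ)*W^2*c9*bN + (122:ℝ)*W^2*c9^2*bN +
    (-96:ℝ)*W^2*c9^3*bN + (24:ℝ)*W^2*c9^4*bN) * bN_cube + ((192:ℝ)*bN^2 + (-1716:ℝ)*c9*bN^2 +
    (5232:ℝ)*c9^2*bN^2 + (-6056:ℝ)*c9^3*bN^2 + (2976:ℝ)*c9^4*bN^2 + (-528:ℝ)*c9^5*bN^2 +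
    (-141756:ℝ)*W + (1239708:ℝ)*W*c9 + (-3640248:ℝ)*W*c9^2 + (4032596:ℝ)*W*c9^3 +
    (-1229808:ℝ)*W*c9^4 + (-810240:ℝ)*W*c9^5 + (643104:ℝ)*W*c9^6 + (-121968:ℝ)*W*c9^7 +
    (-1320:ℝ)*W^2*bN + (5988:ℝ)*W^2*c9*bN + (-5760:ℝ)*W^2*c9^2*bN + (1584:ℝ)*W^2*c9^3*bN) * c9_cube

/-! ## The map `F` -/

/-- `F(W) = b²(1-W³)/Q(W)²`. -/
def enF (W : ℝ) : ℝ := bN ^ 2 * (1 - W ^ 3) / enQ W ^ 2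

/-- `F'(W) = -b²(W-p)²S(W)/Q(W)³`. -/
def enF' (W : ℝ) : ℝ := -(bN ^ 2 * ((W - enP) ^ 2 * enS W)) / enQ W ^ 3

/-- `1 - F = W(W-p)³/Q²` on `[0,∞)`. -/
theorem one_sub_enF {W : ℝ} (h0 : 0 ≤ W) : 1 - enF W = W * (W - enP) ^ 3 / enQ W ^ 2 := by
  rw [enF, one_sub_div (pow_pos (enQ_pos h0) 2).ne', en_key1]

/-- `F(0) = 1`. -/
theorem enF_zero : enF 0 = 1 := by
  have h := one_sub_enF le_rfl
  rw [zero_mul, zero_div] at h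
  linarith

/-- `F(1) = 0`. -/
theorem enF_one : enF 1 = 0 := by simp [enF]

/-- `F` maps `(0,1)` into `(0,1)`. -/
theorem enF_mem {W : ℝ} (hW : W ∈ Ioo (0:ℝ) 1) : enF W ∈ Ioo (0:ℝ) 1 := by
  have hQ := enQ_pos hW.1.le
  refine ⟨div_pos (mul_pos (pow_pos bN_pos 2) (one_sub_pow_three_pos hW)) (pow_pos hQ 2), ?_⟩
  have h := one_sub_enF hW.1.le
  have hp : 0 < W - enP := by linarith [hW.1, enP_neg]
  have : 0 < W * (W - enP) ^ 3 / enQ W ^ 2 := by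
    have := hW.1
    positivity
  linarith

/-- `Q' = 2W + α`. -/
theorem hasDerivAt_enQ (W : ℝ) : HasDerivAt enQ (2 * W + enAl) W := by
  have h := ((hasDerivAt_pow 2 W).add ((hasDerivAt_id' W).const_mul enAl)).add_const bN
  refine h.congr_deriv ?_
  push_cast
  ring

/-- `F'` is the derivative of `F` on `[0,∞)`. -/
theorem hasDerivAt_enF {W : ℝ} (h0 : 0 ≤ W) : HasDerivAt enF (enF' W) W := by
  have hQ := (enQ_pos h0).ne'
  have hden : enQ W ^ 2 ≠ 0 := pow_ne_zero 2 hQ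
  have hN : HasDerivAt (fun y => bN ^ 2 * (1 - y ^ 3))
      (bN ^ 2 * -(((3:ℕ):ℝ) * W ^ (3 - 1))) W :=
    ((hasDerivAt_pow 3 W).const_sub 1).const_mul (bN ^ 2)
  have hD : HasDerivAt (fun y => enQ y ^ 2) (((2:ℕ):ℝ) * enQ W ^ (2 - 1) * (2 * W + enAl)) W :=
    (hasDerivAt_enQ W).fun_pow 2
  refine (hN.div hD hden).congr_deriv ?_
  have hden3 : enQ W ^ 3 ≠ 0 := pow_ne_zero 3 hQ
  have e := en_key2 W
  unfold enF'
  rw [div_eq_div_iff (pow_ne_zero 2 hden) hden3]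
  unfold enQ at e ⊢
  push_cast
  linear_combination (bN ^ 2 * (W ^ 2 + enAl * W + bN) ^ 4) * e

/-- `F' < 0` on `(0,1)`. -/
theorem enF'_neg {W : ℝ} (hW : W ∈ Ioo (0:ℝ) 1) : enF' W < 0 := by
  have hp : 0 < W - enP := by linarith [hW.1, enP_neg]
  have hS := enS_pos hW.1.le hW.2.le
  have hQ := enQ_pos hW.1.le
  unfold enF'
  rw [neg_div]
  exact neg_neg_of_pos (div_pos (mul_pos (pow_pos bN_pos 2) (mul_pos (pow_pos hp 2) hS))
    (pow_pos hQ 3))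

/-- `|F'| = b²(W-p)²S/Q³` on `[0,1]`. -/
theorem abs_enF' {W : ℝ} (h0 : 0 ≤ W) (h1 : W ≤ 1) :
    |enF' W| = bN ^ 2 * ((W - enP) ^ 2 * enS W) / enQ W ^ 3 := by
  have hS := (enS_pos h0 h1).le
  have hQ := enQ_pos h0
  rw [enF', neg_div, abs_neg, abs_of_nonneg (by positivity)]

/-- `F` is continuous on `[0,1]`. -/
theorem continuousOn_enF : ContinuousOn enF (Icc 0 1) := by
  have hq : Continuous enQ := by unfold enQ; fun_prop
  have hn : Continuous (fun W : ℝ => bN ^ 2 * (1 - W ^ 3)) := by fun_prop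
  exact ContinuousOn.div hn.continuousOn (by fun_prop) fun W hW =>
    (pow_pos (enQ_pos hW.1) 2).ne'

/-- `F` is strictly decreasing on `(0,1)`. -/
theorem strictAntiOn_enF : StrictAntiOn enF (Ioo 0 1) := by
  refine strictAntiOn_of_deriv_neg (convex_Ioo 0 1)
    (continuousOn_enF.mono Ioo_subset_Icc_self) fun W hW => ?_
  rw [interior_Ioo] at hW
  rw [(hasDerivAt_enF hW.1.le).deriv]
  exact enF'_neg hW

/-- `F` is injective on `(0,1)`. -/
theorem injOn_enF : InjOn enF (Ioo 0 1) := strictAntiOn_enF.injOn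

/-- `F` maps `(0,1)` ONTO `(0,1)`. -/
theorem image_enF : Ioo (0:ℝ) 1 = enF '' Ioo 0 1 := by
  refine Subset.antisymm ?_ ?_
  · have h := intermediate_value_Ioo' zero_le_one continuousOn_enF
    rwa [enF_one, enF_zero] at h
  · rintro t ⟨W, hW, rfl⟩
    exact enF_mem hW

/-- `F` is `ℚ`-semialgebraic on any `ℚ`-semialgebraic part of `[0,∞)` (a rational function with
algebraic coefficients and non-vanishing denominator). -/
theorem sa_enF {S : Set ℝ} (hS : IsSemialgebraic ℚ (line S)) (hsub : S ⊆ Ici (0:ℝ)) :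
    IsSemialgebraicFunOn ℚ (line S) (fun x : Fin 1 → ℝ => enF (x 0)) := by
  have hX := sa_coord hS
  have hb2 : IsAlgebraic ℚ (bN ^ 2) := isAlgebraic_bN.pow 2
  have hN : IsSemialgebraicFunOn ℚ (line S) (fun x : Fin 1 → ℝ => bN ^ 2 * (1 - x 0 ^ 3)) :=
    (IsSemialgebraicFunOn.mul_holds (isSemialgebraicFunOn_const_of_isAlgebraic hS hb2)
      (isSemialgebraicFunOn_aeval hS (1 - X 0 ^ 3 : MvPolynomial (Fin 1) ℚ))).congr
      fun x _ => by simp only [Pi.mul_apply, map_sub, map_one, map_pow, aeval_X]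
  have hQ : IsSemialgebraicFunOn ℚ (line S) (fun x : Fin 1 → ℝ => enQ (x 0)) :=
    (IsSemialgebraicFunOn.add_holds
      (IsSemialgebraicFunOn.add_holds
        (isSemialgebraicFunOn_aeval hS (X 0 ^ 2 : MvPolynomial (Fin 1) ℚ))
        (IsSemialgebraicFunOn.mul_holds
          (isSemialgebraicFunOn_const_of_isAlgebraic hS isAlgebraic_enAl) hX))
      (isSemialgebraicFunOn_const_of_isAlgebraic hS isAlgebraic_bN)).congr
      fun x _ => by simp only [enQ, Pi.add_apply, Pi.mul_apply, map_pow, aeval_X]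
  have hD : IsSemialgebraicFunOn ℚ (line S) (fun x : Fin 1 → ℝ => enQ (x 0) ^ 2) :=
    (IsSemialgebraicFunOn.mul_holds hQ hQ).congr fun x _ => by simp only [Pi.mul_apply]; ring
  exact (IsSemialgebraicFunOn.div hN hD fun x hx =>
    (pow_pos (enQ_pos (hsub hx)) 2).ne').congr fun x _ => by simp only [enF]

/-- `F` on `line (0,1)`. -/
theorem sa_enF_unit : IsSemialgebraicFunOn ℚ (line (Ioo (0:ℝ) 1)) (fun x => enF (x 0)) :=
  sa_enF mix_line_sa fun _ h => h.1.le

end SoloBlind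

end Summit.KontsevichZagierPeriods.KontsevichZagierPeriods.Theorems
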